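import Summits.BirchSwinnertonDyer.BirchSwinnertonDyer.Theorems.CyclotomicUntwistUntwistingIdentity
import HarnessLib

/-!
# Gauss sums of PRIMITIVE characters over the non-field `ℤ/p^c`, and the primitivity inputs of the
# untwisting identity (★) of D1 (`CyclotomicUntwistUntwistingIdentity`)

Cell `pub/bsd-wall` (D-0145 line `route-BirchSwinnertonDyer-CyclotomicUntwist`), seat `bsd-line-cycu-p1`
(prover seat 1/3, K1 base), helper toward crux K1 `PSRankOneLowerHalfAtThree`
(stmt-BirchSwinnertonDyer-21580). THEOREMS ONLY (no definition, no named fact, no `sorry`); BSD is not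
proved by this file and no crux is.

The untwisting identity `untwistSymbolSum p f η χ = η(−1) · g(η, ψ_χ) · ratTwistedSymbolSum f (χ η↑)`
(`PSUntwisting.untwistSymbolSum_eq`) is non-degenerate exactly when the Gauss sum `g(η, ψ_χ)` over `ℤ/p^c`
is non-zero. `ℤ/p^c` (`c ≥ 2`: the route has `p^c = 9`) is NOT a field, so Mathlib's
`gaussSum_mul_gaussSum_eq_card` / `gaussSum_ne_zero_of_nontrivial` (stated over finite FIELDS) do not
apply; this file supplies the prime-power-modulus versions and the two primitivity facts (★) needs:

* §1 for `η` PRIMITIVE mod `p^c` (`c ≥ 1`) and any additive `ψ`: the shifted sums `∑_x η(x)ψ(ax)` VANISH at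
  non-units `a` (`gaussSum_mulShift_eq_zero_of_not_isUnit`: primitivity gives a unit `u ≡ 1 (p^{c−1})` with
  `η(u) ≠ 1`, and `au = a`); hence for `ψ` PRIMITIVE the product formula `g(η,ψ)·g(η̄,ψ̄) = p^c`
  (`gaussSum_mul_gaussSum_inv_eq`: sum `g(η,ψ_a)g(η̄,ψ̄_a)` over ALL `a ∈ ℤ/p^c` — units give `g ḡ` each,
  non-units `0`; orthogonality `∑_a ψ(ab) = p^c [b = 0]` gives `p^c · #units`) and
  `gaussSum_ne_zero_of_isPrimitive`;
* §2 an additive character of `ℤ/p^c` non-trivial at `p^{c−1}` is primitive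
  (`addChar_isPrimitive_of_apply_ne_one`); a primitive `χ` mod `pⁿ` (`n ≥ 2`) has `χ(1 + p^{n−1}) ≠ 1`
  (`apply_one_add_pow_ne_one` — else `k ↦ χ(1 + p^{n−1}k)`, an additive character of `ℤ/p` by
  `PSUntwisting.exists_addChar_eq`, is trivial and `χ` factors through `p^{n−1}`); so
  `ψ_χ : y ↦ χ(1 + p^{n−c}y)` is primitive for `χ` primitive, `1 ≤ c`, `2c ≤ n`
  (`isPrimitive_of_eq_untwistAddChar`); and `χ := η̄↑·ξ` is primitive of level `pⁿ` when `ξ` is and `c < n`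
  (`isPrimitive_inv_changeLevel_mul`), satisfying D1's compatibility clause
  (`inv_changeLevel_mul_apply_natCast`, `inv_changeLevel_mul_mul_changeLevel`).
Consumed by `CyclotomicUntwistUntwistedNonvanishing` (`𝓛^η ≢ 0`).

References: Gauss sums modulo prime powers [folklore]; [cite: MazurTateTeitelbaum1986Invent, §I.14] for
the role of `χ = η̄ξ`.
-/

noncomputable section

open scoped MatrixGroups

open CongruenceSubgroup DirichletCharacter Literature.NumberTheory.EllipticCurves
  Literature.NumberTheory.EllipticCurves.ModularForms Literature.NumberTheory.IwasawaTheory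
  Summit.BirchSwinnertonDyer.BirchSwinnertonDyer.Theorems.PSUntwisting

-- single-conjunct summit: `Summit.BirchSwinnertonDyer.BirchSwinnertonDyer.…` repeats the name by design
set_option linter.dupNamespace false
set_option autoImplicit false

namespace Summit.BirchSwinnertonDyer.BirchSwinnertonDyer.Theorems.PSPrimePowerGauss

variable {p : ℕ} [Fact p.Prime]

/-! ### §0 Two more facts on `ℤ/pⁿ` -/

section ZModPow

variable {n : ℕ}

/-- An element of `ℤ/pⁿ` killed by reduction to `ℤ/p^d` is `p^d` times a natural number. [folklore] -/
theorem exists_eq_pow_mul_of_castHom_eq_zero {d : ℕ} (hdn : d ≤ n) {X : ZMod (p ^ n)}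
    (h : ZMod.castHom (pow_dvd_pow p hdn) (ZMod (p ^ d)) X = 0) :
    ∃ q : ℕ, X = ((p ^ d : ℕ) : ZMod (p ^ n)) * (q : ZMod (p ^ n)) := by
  haveI : NeZero (p ^ n) := ⟨pow_ne_zero _ (Fact.out : p.Prime).ne_zero⟩
  rw [← ZMod.natCast_zmod_val X, map_natCast, ZMod.natCast_eq_zero_iff] at h
  obtain ⟨q, hq⟩ := h
  exact ⟨q, by rw [← ZMod.natCast_zmod_val X, hq, Nat.cast_mul]⟩

/-- A unit of `ℤ/pⁿ` reducing to `1` in `ℤ/p^d` is `1 + p^d·q`. [folklore] -/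
theorem exists_eq_one_add_of_unitsMap_eq_one {d : ℕ} (hdn : d ≤ n) {u : (ZMod (p ^ n))ˣ}
    (hu : ZMod.unitsMap (pow_dvd_pow p hdn) u = 1) :
    ∃ q : ℕ, (u : ZMod (p ^ n)) = 1 + ((p ^ d : ℕ) : ZMod (p ^ n)) * (q : ZMod (p ^ n)) := by
  have h1 : ZMod.castHom (pow_dvd_pow p hdn) (ZMod (p ^ d)) ((u : ZMod (p ^ n)) - 1) = 0 := by
    have := congrArg (fun x : (ZMod (p ^ d))ˣ ↦ (x : ZMod (p ^ d))) hu
    simp only [ZMod.unitsMap_def, Units.coe_map, MonoidHom.coe_coe, Units.val_one] at this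
    rw [map_sub, map_one, this, sub_self]
  obtain ⟨q, hq⟩ := exists_eq_pow_mul_of_castHom_eq_zero hdn h1
  exact ⟨q, by rw [← hq]; ring⟩

/-- A non-unit of `ℤ/pⁿ` (`n ≥ 1`) is `p` times a natural number. [folklore] -/
theorem exists_eq_p_mul_of_not_isUnit (hn : 0 < n) {a : ZMod (p ^ n)} (ha : ¬ IsUnit a) :
    ∃ k : ℕ, a = (p : ZMod (p ^ n)) * (k : ZMod (p ^ n)) := by
  haveI : NeZero (p ^ n) := ⟨pow_ne_zero _ (Fact.out : p.Prime).ne_zero⟩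
  rw [isUnit_iff_coprime_val hn, Nat.coprime_comm, Nat.Prime.coprime_iff_not_dvd Fact.out, not_not] at ha
  obtain ⟨k, hk⟩ := ha
  exact ⟨k, by rw [← ZMod.natCast_zmod_val a, hk, Nat.cast_mul]⟩

end ZModPow

/-! ### §1 Gauss sums of primitive characters over `ℤ/p^c` -/

section Gauss

variable {c : ℕ} (η : DirichletCharacter ℂ_[p] (p ^ c))

/-- A PRIMITIVE character mod `p^c` (`c ≥ 1`) is non-trivial on the kernel of reduction to `p^{c−1}`:
some unit `u ≡ 1 (mod p^{c−1})` has `η(u) ≠ 1`. [folklore] -/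
theorem exists_unitsMap_eq_one_apply_ne_one (hc : 0 < c) (hη : η.IsPrimitive) :
    ∃ u : (ZMod (p ^ c))ˣ, ZMod.unitsMap (pow_dvd_pow p (Nat.sub_le c 1)) u = 1 ∧ η u ≠ 1 := by
  haveI : NeZero (p ^ c) := ⟨pow_ne_zero _ (Fact.out : p.Prime).ne_zero⟩
  by_contra h
  push Not at h
  have hfac : η.FactorsThrough (p ^ (c - 1)) := by
    rw [factorsThrough_iff_ker_unitsMap (pow_dvd_pow p (Nat.sub_le c 1))]
    intro u hu
    rw [MonoidHom.mem_ker] at hu ⊢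
    apply Units.ext
    rw [MulChar.coe_toUnitHom, Units.val_one]
    exact h u hu
  have hle : η.conductor ≤ p ^ (c - 1) := Nat.sInf_le ((mem_conductorSet_iff η).mpr hfac)
  have hprim : η.conductor = p ^ c := hη
  have hlt : p ^ (c - 1) < p ^ c := Nat.pow_lt_pow_right (Fact.out : p.Prime).one_lt (by omega)
  omega

/-- For such a `u` and a NON-unit `a` of `ℤ/p^c`: `a·u = a` (`a = p·k`, `p·u = p`). [folklore] -/
theorem mul_eq_self_of_not_isUnit (hc : 0 < c) {u : (ZMod (p ^ c))ˣ}
    (hu : ZMod.unitsMap (pow_dvd_pow p (Nat.sub_le c 1)) u = 1) {a : ZMod (p ^ c)} (ha : ¬ IsUnit a) :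
    a * u = a := by
  obtain ⟨k, rfl⟩ := exists_eq_p_mul_of_not_isUnit hc ha
  obtain ⟨q, hq⟩ := exists_eq_one_add_of_unitsMap_eq_one (Nat.sub_le c 1) hu
  have hpp : (p : ZMod (p ^ c)) * ((p ^ (c - 1) : ℕ) : ZMod (p ^ c)) = 0 := by
    rw [← Nat.cast_mul, ← pow_succ', Nat.sub_add_cancel hc, ZMod.natCast_self]
  rw [hq]
  linear_combination ((k : ZMod (p ^ c)) * (q : ZMod (p ^ c))) * hpp

/-- **Shifted Gauss sums of a primitive character vanish at non-units**: for `η` primitive mod `p^c`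
(`c ≥ 1`), any additive `ψ` and `a ∉ (ℤ/p^c)ˣ`, `∑_x η(x) ψ(a x) = 0` (re-index `x ↦ ux` with
`η(u) ≠ 1`, `au = a`). [folklore] -/
theorem gaussSum_mulShift_eq_zero_of_not_isUnit (hc : 0 < c) (hη : η.IsPrimitive)
    (ψ : AddChar (ZMod (p ^ c)) ℂ_[p]) {a : ZMod (p ^ c)} (ha : ¬ IsUnit a) :
    gaussSum η (ψ.mulShift a) = 0 := by
  obtain ⟨u, hu, hηu⟩ := exists_unitsMap_eq_one_apply_ne_one η hc hη
  have hau : a * u = a := mul_eq_self_of_not_isUnit hc hu ha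
  set S := gaussSum η (ψ.mulShift a) with hS
  have hfix : S = η u * S := by
    rw [hS, gaussSum, Finset.mul_sum]
    refine (Fintype.sum_bijective (fun x : ZMod (p ^ c) ↦ (u : ZMod (p ^ c)) * x)
      (Units.mulLeft_bijective u) _ _ fun x ↦ ?_).symm
    simp only [AddChar.mulShift_apply, map_mul]
    rw [show a * ((u : ZMod (p ^ c)) * x) = a * u * x by ring, hau, mul_assoc]
  have h0 : (η u - 1) * S = 0 := by linear_combination -hfix
  exact (mul_eq_zero.mp h0).resolve_left (sub_ne_zero.mpr hηu)

/-- For a UNIT `a`, the two shifted Gauss sums multiply to the unshifted product: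
`g(η, ψ_a) · g(η̄, ψ̄_a) = g(η, ψ) · g(η̄, ψ̄)`. [folklore] -/
theorem gaussSum_mulShift_mul_of_isUnit (ψ : AddChar (ZMod (p ^ c)) ℂ_[p]) (a : (ZMod (p ^ c))ˣ) :
    gaussSum η (ψ.mulShift a) * gaussSum η⁻¹ (ψ⁻¹.mulShift a) =
      gaussSum η ψ * gaussSum η⁻¹ ψ⁻¹ := by
  rw [gaussSum_mulShift_eq, gaussSum_mulShift_eq, inv_inv]
  have h1 : η⁻¹ (a : ZMod (p ^ c)) * η a = 1 := by
    rw [← MulChar.mul_apply, inv_mul_cancel, MulChar.one_apply_coe]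
  linear_combination (gaussSum η ψ * gaussSum η⁻¹ ψ⁻¹) * h1

/-- Every shifted product equals `𝟙(a) · g ḡ` (`𝟙` the trivial character: `1` on units, `0` off them).
[folklore] -/
theorem gaussSum_mulShift_mul_eq (hc : 0 < c) (hη : η.IsPrimitive) (ψ : AddChar (ZMod (p ^ c)) ℂ_[p])
    (a : ZMod (p ^ c)) :
    gaussSum η (ψ.mulShift a) * gaussSum η⁻¹ (ψ⁻¹.mulShift a) =
      (1 : MulChar (ZMod (p ^ c)) ℂ_[p]) a * (gaussSum η ψ * gaussSum η⁻¹ ψ⁻¹) := by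
  by_cases ha : IsUnit a
  · obtain ⟨u, rfl⟩ := ha
    rw [gaussSum_mulShift_mul_of_isUnit, MulChar.one_apply_coe, one_mul]
  · rw [gaussSum_mulShift_eq_zero_of_not_isUnit η hc hη ψ ha, zero_mul, MulChar.map_nonunit _ ha,
      zero_mul]

/-- The double sum behind the product formula: `∑_a g(η,ψ_a) g(η̄, ψ̄_a) = p^c · #(ℤ/p^c)ˣ` for `ψ`
primitive (orthogonality `∑_a ψ(a b) = p^c [b = 0]`). [folklore] -/
theorem sum_gaussSum_mulShift_mul {ψ : AddChar (ZMod (p ^ c)) ℂ_[p]} (hψ : ψ.IsPrimitive) :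
    ∑ a : ZMod (p ^ c), gaussSum η (ψ.mulShift a) * gaussSum η⁻¹ (ψ⁻¹.mulShift a) =
      (Fintype.card (ZMod (p ^ c)) : ℂ_[p]) * Fintype.card (ZMod (p ^ c))ˣ := by
  classical
  -- expand each shifted product as a double sum
  have hexp : ∀ a : ZMod (p ^ c), gaussSum η (ψ.mulShift a) * gaussSum η⁻¹ (ψ⁻¹.mulShift a) =
      ∑ x : ZMod (p ^ c), ∑ y : ZMod (p ^ c), η x * η⁻¹ y * ψ (a * (x - y)) := by
    intro a
    rw [gaussSum, gaussSum, Finset.sum_mul_sum]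
    refine Finset.sum_congr rfl fun x _ ↦ Finset.sum_congr rfl fun y _ ↦ ?_
    rw [AddChar.mulShift_apply, AddChar.mulShift_apply, AddChar.inv_apply, mul_sub, sub_eq_add_neg,
      AddChar.map_add_eq_mul]
    ring
  -- orthogonality in `a`
  have horth : ∀ x y : ZMod (p ^ c), ∑ a : ZMod (p ^ c), ψ (a * (x - y)) =
      if x - y = 0 then (Fintype.card (ZMod (p ^ c)) : ℂ_[p]) else 0 := fun x y ↦ by
    rw [AddChar.sum_mulShift (x - y) hψ]
    split_ifs <;> simp
  have h1 : ∀ x : ZMod (p ^ c), η x * η⁻¹ x = (1 : MulChar (ZMod (p ^ c)) ℂ_[p]) x := fun x ↦ by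
    rw [← MulChar.mul_apply, mul_inv_cancel]
  calc ∑ a : ZMod (p ^ c), gaussSum η (ψ.mulShift a) * gaussSum η⁻¹ (ψ⁻¹.mulShift a)
      = ∑ a : ZMod (p ^ c), ∑ x : ZMod (p ^ c), ∑ y : ZMod (p ^ c), η x * η⁻¹ y * ψ (a * (x - y)) :=
        Finset.sum_congr rfl fun a _ ↦ hexp a
    _ = ∑ x : ZMod (p ^ c), ∑ y : ZMod (p ^ c), ∑ a : ZMod (p ^ c), η x * η⁻¹ y * ψ (a * (x - y)) := by
        rw [Finset.sum_comm]
        exact Finset.sum_congr rfl fun x _ ↦ Finset.sum_comm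
    _ = ∑ x : ZMod (p ^ c), ∑ y : ZMod (p ^ c),
          η x * η⁻¹ y * (if x - y = 0 then (Fintype.card (ZMod (p ^ c)) : ℂ_[p]) else 0) := by
        refine Finset.sum_congr rfl fun x _ ↦ Finset.sum_congr rfl fun y _ ↦ ?_
        rw [← Finset.mul_sum, horth]
    _ = ∑ x : ZMod (p ^ c), η x * η⁻¹ x * (Fintype.card (ZMod (p ^ c)) : ℂ_[p]) := by
        refine Finset.sum_congr rfl fun x _ ↦ ?_
        simp_rw [sub_eq_zero, mul_ite, mul_zero]
        rw [Finset.sum_ite_eq, if_pos (Finset.mem_univ x)]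
    _ = (Fintype.card (ZMod (p ^ c)) : ℂ_[p]) * Fintype.card (ZMod (p ^ c))ˣ := by
        simp_rw [h1, ← Finset.sum_mul, MulChar.sum_one_eq_card_units]
        ring

/-- **Product formula** for a PRIMITIVE `η` mod `p^c` (`c ≥ 1`) and a PRIMITIVE additive `ψ`:
`g(η, ψ) · g(η̄, ψ̄) = p^c` (`= #ℤ/p^c`). [folklore] -/
theorem gaussSum_mul_gaussSum_inv_eq (hc : 0 < c) (hη : η.IsPrimitive) {ψ : AddChar (ZMod (p ^ c)) ℂ_[p]}
    (hψ : ψ.IsPrimitive) :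
    gaussSum η ψ * gaussSum η⁻¹ ψ⁻¹ = Fintype.card (ZMod (p ^ c)) := by
  have hsum := sum_gaussSum_mulShift_mul η hψ
  simp_rw [gaussSum_mulShift_mul_eq η hc hη ψ, ← Finset.sum_mul, MulChar.sum_one_eq_card_units] at hsum
  have hU : (Fintype.card (ZMod (p ^ c))ˣ : ℂ_[p]) ≠ 0 := Nat.cast_ne_zero.mpr Fintype.card_ne_zero
  have := mul_left_cancel₀ hU (hsum.trans (mul_comm _ _))
  exact this

/-- **`g(η, ψ) ≠ 0`** for `η` primitive mod `p^c` (`c ≥ 1`) and `ψ` primitive. [folklore] -/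
theorem gaussSum_ne_zero_of_isPrimitive (hc : 0 < c) (hη : η.IsPrimitive)
    {ψ : AddChar (ZMod (p ^ c)) ℂ_[p]} (hψ : ψ.IsPrimitive) : gaussSum η ψ ≠ 0 := by
  intro h0
  have h := gaussSum_mul_gaussSum_inv_eq η hc hη hψ
  rw [h0, zero_mul] at h
  exact (Nat.cast_ne_zero.mpr Fintype.card_ne_zero) h.symm

end Gauss

/-! ### §2 Primitivity of `ψ_χ` and of `χ = η̄↑·ξ` -/

section Primitive

variable {c n : ℕ}

/-- An additive character of `ℤ/p^c` (`c ≥ 1`) that is non-trivial at `p^{c−1}` is PRIMITIVE: a non-zero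
`a = p^j m` (`p ∤ m`, `j < c`) has `a · (p^{c−1−j} m⁻¹) = p^{c−1}`. [folklore] -/
theorem addChar_isPrimitive_of_apply_ne_one (hc : 0 < c) {ψ : AddChar (ZMod (p ^ c)) ℂ_[p]}
    (h : ψ ((p ^ (c - 1) : ℕ) : ZMod (p ^ c)) ≠ 1) : ψ.IsPrimitive := by
  haveI : NeZero (p ^ c) := ⟨pow_ne_zero _ (Fact.out : p.Prime).ne_zero⟩
  have hp : p.Prime := Fact.out
  intro a ha hone
  have hval : a.val ≠ 0 := by rwa [Ne, ZMod.val_eq_zero]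
  obtain ⟨j, m, hm, hjm⟩ := Nat.exists_eq_pow_mul_and_not_dvd hval p hp.ne_one
  have hm0 : m ≠ 0 := by rintro rfl; exact hm (dvd_zero p)
  have hj : j < c := by
    by_contra hjc
    push Not at hjc
    have h1 : p ^ c ≤ a.val := by
      rw [hjm]
      exact le_trans (Nat.pow_le_pow_right hp.pos hjc) (Nat.le_mul_of_pos_right _ (Nat.pos_of_ne_zero hm0))
    exact absurd (ZMod.val_lt a) (not_lt.mpr h1)
  have hmu : IsUnit (m : ZMod (p ^ c)) := by
    rw [ZMod.isUnit_iff_coprime]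
    exact (Nat.coprime_pow_right_iff hc _ _).mpr ((Nat.Prime.coprime_iff_not_dvd hp).mpr hm).symm
  obtain ⟨mu, hmu'⟩ := hmu
  have key : ψ.mulShift a (((p ^ (c - 1 - j) : ℕ) : ZMod (p ^ c)) * ((mu⁻¹ : (ZMod (p ^ c))ˣ) : ZMod (p ^ c)))
      = ψ ((p ^ (c - 1) : ℕ) : ZMod (p ^ c)) := by
    rw [AddChar.mulShift_apply]
    congr 1
    have ha' : a = ((p ^ j : ℕ) : ZMod (p ^ c)) * (mu : ZMod (p ^ c)) := by
      rw [← ZMod.natCast_zmod_val a, hjm, Nat.cast_mul, hmu']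
    rw [ha', show ((p ^ j : ℕ) : ZMod (p ^ c)) * (mu : ZMod (p ^ c)) *
        (((p ^ (c - 1 - j) : ℕ) : ZMod (p ^ c)) * ((mu⁻¹ : (ZMod (p ^ c))ˣ) : ZMod (p ^ c))) =
        ((p ^ j : ℕ) : ZMod (p ^ c)) * ((p ^ (c - 1 - j) : ℕ) : ZMod (p ^ c)) *
          ((mu : ZMod (p ^ c)) * ((mu⁻¹ : (ZMod (p ^ c))ˣ) : ZMod (p ^ c))) by ring,
      Units.mul_inv, mul_one, ← Nat.cast_mul, ← pow_add, show j + (c - 1 - j) = c - 1 by omega]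
  rw [hone, AddChar.one_apply] at key
  exact h key.symm

/-- A PRIMITIVE Dirichlet character mod `pⁿ`, `n ≥ 2`, is non-trivial at `1 + p^{n−1}`: otherwise it
kills the (cyclic) kernel of `(ℤ/pⁿ)ˣ → (ℤ/p^{n−1})ˣ` — `k ↦ χ(1 + p^{n−1}k)` is an additive character
of `ℤ/p` (`exists_addChar_eq` with `c = 1`) trivial at `1` — and factors through `p^{n−1}`. [folklore] -/
theorem apply_one_add_pow_ne_one (χ : DirichletCharacter ℂ_[p] (p ^ n)) (hn : 2 ≤ n)
    (hχ : χ.IsPrimitive) : χ (1 + ((p ^ (n - 1) : ℕ) : ZMod (p ^ n))) ≠ 1 := by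
  haveI : NeZero (p ^ n) := ⟨pow_ne_zero _ (Fact.out : p.Prime).ne_zero⟩
  haveI : NeZero (p ^ 1) := ⟨pow_ne_zero _ (Fact.out : p.Prime).ne_zero⟩
  have hp : p.Prime := Fact.out
  intro h1
  obtain ⟨lam, hlam⟩ := exists_addChar_eq χ (c := 1) (by omega) (by omega)
  have hlam1 : lam 1 = 1 := by
    rw [hlam, ZMod.val_one'' (by
      rw [pow_one]; exact hp.one_lt.ne'), Nat.cast_one, mul_one, h1]
  have hlamtriv : ∀ y : ZMod (p ^ 1), lam y = 1 := fun y ↦ by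
    have hy : y = y.val • (1 : ZMod (p ^ 1)) := by rw [nsmul_eq_mul, mul_one, ZMod.natCast_zmod_val]
    rw [hy, AddChar.map_nsmul_eq_pow, hlam1, one_pow]
  have hfac : χ.FactorsThrough (p ^ (n - 1)) := by
    rw [factorsThrough_iff_ker_unitsMap (pow_dvd_pow p (Nat.sub_le n 1))]
    intro u hu
    rw [MonoidHom.mem_ker] at hu ⊢
    apply Units.ext
    rw [MulChar.coe_toUnitHom, Units.val_one]
    obtain ⟨q, hq⟩ := exists_eq_one_add_of_unitsMap_eq_one (Nat.sub_le n 1) hu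
    have hlift : ((p ^ (n - 1) : ℕ) : ZMod (p ^ n)) * (q : ZMod (p ^ n)) =
        ((p ^ (n - 1) : ℕ) : ZMod (p ^ n)) * (((q : ZMod (p ^ 1)).val : ℕ) : ZMod (p ^ n)) := by
      refine mul_eq_mul_of_castHom_eq (p := p) (n := n) (c := 1) (by omega) ?_
      rw [map_natCast, castHom_natCast_val (p := p) (by omega)]
    rw [hq, hlift, ← hlam, hlamtriv]
  have hle : χ.conductor ≤ p ^ (n - 1) := Nat.sInf_le ((mem_conductorSet_iff χ).mpr hfac)
  have hprim : χ.conductor = p ^ n := hχ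
  have hlt : p ^ (n - 1) < p ^ n := Nat.pow_lt_pow_right hp.one_lt (by omega)
  omega

/-- **`ψ_χ` is primitive**: for `χ` primitive mod `pⁿ` with `1 ≤ c`, `2c ≤ n`, the additive character
`ψ(y) = χ(1 + p^{n−c}y)` of `ℤ/p^c` is primitive (`ψ(p^{c−1}) = χ(1 + p^{n−1}) ≠ 1`). [folklore] -/
theorem isPrimitive_of_eq_untwistAddChar (hc : 0 < c) (h2 : 2 * c ≤ n)
    (χ : DirichletCharacter ℂ_[p] (p ^ n)) (hχ : χ.IsPrimitive) (ψ : AddChar (ZMod (p ^ c)) ℂ_[p])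
    (hψ : ∀ y : ZMod (p ^ c), ψ y = χ (1 + ((p ^ (n - c) : ℕ) : ZMod (p ^ n)) * ((y.val : ℕ) : ZMod (p ^ n)))) :
    ψ.IsPrimitive := by
  have hp : p.Prime := Fact.out
  refine addChar_isPrimitive_of_apply_ne_one hc ?_
  rw [hψ, ZMod.val_natCast_of_lt (Nat.pow_lt_pow_right hp.one_lt (by omega)), ← Nat.cast_mul, ← pow_add,
    show n - c + (c - 1) = n - 1 by omega]
  exact apply_one_add_pow_ne_one χ (by omega) hχ

variable (η : DirichletCharacter ℂ_[p] (p ^ c))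

/-- D1's compatibility clause for `χ := η̄↑ · ξ`: `χ(a) = η(a)⁻¹ ξ(a)` for `a` prime to `p`. [folklore] -/
theorem inv_changeLevel_mul_apply_natCast (hc : 0 < c) (hcn : c ≤ n) (ξ : DirichletCharacter ℂ_[p] (p ^ n))
    (a : ℕ) (ha : a.Coprime p) :
    (changeLevel (pow_dvd_pow p hcn) η⁻¹ * ξ) (a : ZMod (p ^ n)) =
      (η (a : ZMod (p ^ c)))⁻¹ * ξ (a : ZMod (p ^ n)) := by
  have hn : 0 < n := lt_of_lt_of_le hc hcn
  have hu : IsUnit (a : ZMod (p ^ n)) := by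
    rw [ZMod.isUnit_iff_coprime]; exact (Nat.coprime_pow_right_iff hn _ _).mpr ha
  obtain ⟨u, hu'⟩ := hu
  rw [MulChar.mul_apply, ← hu', changeLevel_eq_cast_of_dvd, hu', ZMod.cast_natCast (pow_dvd_pow p hcn),
    MulChar.inv_apply_eq_inv']

/-- `χ · η↑ = ξ` for `χ := η̄↑ · ξ`. [folklore] -/
theorem inv_changeLevel_mul_mul_changeLevel (hcn : c ≤ n) (ξ : DirichletCharacter ℂ_[p] (p ^ n)) :
    changeLevel (pow_dvd_pow p hcn) η⁻¹ * ξ * changeLevel (pow_dvd_pow p hcn) η = ξ := by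
  rw [mul_comm, ← mul_assoc, ← map_mul, mul_inv_cancel, map_one, one_mul]

/-- **`χ := η̄↑ · ξ` is primitive of level `pⁿ`** when `ξ` is primitive mod `pⁿ` and `c < n`: if `χ`
factored through `p^{n−1}` then so would `ξ = χ · η↑`. [folklore] -/
theorem isPrimitive_inv_changeLevel_mul (hcn : c < n) (ξ : DirichletCharacter ℂ_[p] (p ^ n))
    (hξ : ξ.IsPrimitive) :
    (changeLevel (pow_dvd_pow p hcn.le) η⁻¹ * ξ).IsPrimitive := by
  haveI : NeZero (p ^ n) := ⟨pow_ne_zero _ (Fact.out : p.Prime).ne_zero⟩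
  have hp : p.Prime := Fact.out
  set χ := changeLevel (pow_dvd_pow p hcn.le) η⁻¹ * ξ with hχdef
  by_contra hnot
  -- the conductor of `χ` is `p^j` with `j < n`
  obtain ⟨j, hj, hcond⟩ := (Nat.dvd_prime_pow hp).mp (conductor_dvd_level χ)
  have hjn : j < n := by
    rcases hj.lt_or_eq with hlt | heq
    · exact hlt
    · exact absurd (hcond.trans (congrArg _ heq)) hnot
  have hχfac : χ.FactorsThrough (p ^ (n - 1)) :=
    FactorsThrough.mono χ (hcond ▸ factorsThrough_conductor χ) (pow_dvd_pow p (by omega))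
      (pow_dvd_pow p (Nat.sub_le n 1))
  have hηfac : (changeLevel (pow_dvd_pow p hcn.le) η).FactorsThrough (p ^ (n - 1)) := by
    refine ⟨pow_dvd_pow p (Nat.sub_le n 1), changeLevel (pow_dvd_pow p (by omega : c ≤ n - 1)) η, ?_⟩
    rw [← changeLevel_trans]
  obtain ⟨h1, χ₀, hχ₀⟩ := hχfac
  obtain ⟨h2, η₀, hη₀⟩ := hηfac
  have hξfac : ξ.FactorsThrough (p ^ (n - 1)) := by
    refine ⟨h1, χ₀ * η₀, ?_⟩
    have h12 : (changeLevel h1) η₀ = (changeLevel h2) η₀ := rfl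
    rw [map_mul, ← hχ₀, h12, ← hη₀, hχdef, inv_changeLevel_mul_mul_changeLevel η hcn.le ξ]
  have hle : ξ.conductor ≤ p ^ (n - 1) := Nat.sInf_le ((mem_conductorSet_iff ξ).mpr hξfac)
  have hprim : ξ.conductor = p ^ n := hξ
  have hlt : p ^ (n - 1) < p ^ n := Nat.pow_lt_pow_right hp.one_lt (by omega)
  omega

end Primitive

end Summit.BirchSwinnertonDyer.BirchSwinnertonDyer.Theorems.PSPrimePowerGauss
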